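import Summits.Ventures.HSemireg.WedgeHankelRecurrenceGaussChebyshevDiscriminant

/-!
# Venture HSemireg — **THE DISCRIMINANT OF THE LAGUERRE POLYNOMIALS** (monic recurrence `a_n = 2n + 1 + α`, `b_{n+1} = (n+1)(n+1+α)`, ANY real `α`): by SCHUR's method (N404) with the
# lowering relation `X L_{n+1}′ = (n+1) L_{n+1} + (n+1)(n+1+α) L_n` (N389) and `Res(L_{n+1}, X) = (−1)^{n+1} L_{n+1}(0) = ∏_{k ≤ n} (k+1+α)` (N376):
# **`∏_{k ≤ n} (k+1+α) · disc(L_{n+1}) = ((n+1)(n+1+α))^{n+1} ∏_{k<n} ((k+1)(k+1+α))^{k+1}`**, hence for `α ∉ {−1, −2, …, −(n+1)}` (e.g. `α > −1`) STIELTJES–HILBERT's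
# **`disc(L_{n+1}^{(α)}) = ∏_{ν=1}^{n+1} ν^ν (ν + α)^{ν−1}`**, and at the zeros `(∏_{i<j} (x_j − x_i))² = ∏ ν^ν (ν+α)^{ν−1}`

HONEST FRAMING. Part of the Lean index of the computation cell `pub-hsemireg` (seat p10 gen 47, Sunday typer «UNIFORM-IN-n»).  Polynomial algebra over `ℝ` (Mathlib `Polynomial.resultant ∕ discr`) only;
no variety, no cohomology theory, no sheaf, no Ext group and no semiregularity map is constructed here; nothing here says that HC / HC_CM / HC_AV holds; no Literature fact (unproved `Prop`) is
declared or used.  Custodian versions as in `WedgeHankelSiegelIdeal` (1/3).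
SOURCES (cited).  T. J. Stieltjes, *Sur les polynômes de Jacobi* ∕ *Sur quelques théorèmes d'algèbre*, C. R. Acad. Sci. Paris 100 (1885) 439–440, 620–622; D. Hilbert, J. reine angew. Math. 103 (1888)
337–345; I. Schur, J. reine angew. Math. 165 (1931) 52–58, §3 (Laguerre); G. Szegő, *Orthogonal Polynomials*, Thm 6.71, eq. (6.71.6) (`D_n^{(α)} = ∏_{ν=1}^{n} ν^{ν−2n+2} (ν+α)^{ν−1}` for the
standard `L_n^{(α)}`; the monic rescaling by `(n!)^{2n−2}` gives `∏ ν^ν (ν+α)^{ν−1}`).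
PROOF TYPED HERE.  N404 `resultant_mul_discr_recurrence` with `π = X`, `d = 1`, `A = C(n+1)`, `c = (n+1)(n+1+α)`; `Res_{(n+1,1)}(L_{n+1}, X) = (−1)^{n+1} L_{n+1}(0)` (Mathlib `resultant_X_sub_C_right`
at `r = 0`) and N376 `laguerre_alt_eval_zero`; the closed form by cancelling `∏ (k+1+α) ≠ 0`; the zero form by N653-block `discr_prod_X_sub_C`.
DEDUP DISCLOSURE (`rg -n -i 'laguerre.*discr|discr.*laguerre' Summits/Ventures/HSemireg Literature`, 2026-09-04): nothing; N389 `laguerre_structure_relation`, N376 `laguerre_alt_eval_zero ∕ laguerre_zeros`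
reused; 0 hits for the 4 names below.

WHAT IS IN THE TREE.  N404 `resultant_mul_discr_recurrence`; N389 `laguerre_structure_relation`; N376 `laguerre_alt_eval_zero`, `laguerre_zeros`; N653-block `discr_prod_X_sub_C`; Mathlib
`resultant_X_sub_C_right`.
THIS FILE (namespace `Summit.Ventures.HSemireg.Wedge.HankelOuter` continued; CHAINED on N407 (import only); 0 definitions):
* §1173 `laguerre_resultant_X` (`Res_{(n+1,1)}(L_{n+1}, X) = ∏_{k ≤ n} (k+1+α)`), **`laguerre_discr_mul`** (the product identity, every real `α`), **`laguerre_discr`** (`disc L_{n+1} = ∏_{k ≤ n} (k+1)^{k+1}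
  (k+1+α)^k` when `∏ (k+1+α) ≠ 0`), `laguerre_discr_of_gt` (`α > −1`), **`laguerre_zeros_discr`** (`(∏_{i<j}(x_j − x_i))² = ∏ (k+1)^{k+1} (k+1+α)^k` whenever `L_{t+1} = ∏ (X − x_k)`, `α > −1`).
CAVEATS.  Monic normalisation throughout (Szegő's `L_n^{(α)}` has leading coefficient `(−1)^n∕n!`).  Nothing Ext-side.  New names only.
-/

open Module Polynomial
open scoped Matrix Polynomial

namespace Summit.Ventures.HSemireg.Wedge.HankelOuter

/-! ## §1173. The Laguerre discriminant -/

/-- `Res_{(n+1,1)}(L_{n+1}, X) = (−1)^{n+1} L_{n+1}(0) = ∏_{k ≤ n} (k + 1 + α)`. [Szegő (5.1.7); this file, §1173] -/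
theorem laguerre_resultant_X {L : ℕ → ℝ[X]} {a b : ℕ → ℝ} {α : ℝ} (hL0 : L 0 = 1) (hL1 : L 1 = Polynomial.X - C (a 0))
    (hLrec : ∀ n, L (n + 2) = (Polynomial.X - C (a (n + 1))) * L (n + 1) - C (b (n + 1)) * L n) (ha : ∀ n, a n = 2 * n + 1 + α)
    (hb : ∀ n, b (n + 1) = ((n : ℝ) + 1) * ((n : ℝ) + 1 + α)) (n : ℕ) :
    (L (n + 1)).resultant Polynomial.X (n + 1) 1 = ∏ k ∈ Finset.range (n + 1), ((k : ℝ) + 1 + α) := by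
  obtain ⟨hd, -⟩ := recurrence_natDegree_le_coeff hL0 hL1 hLrec (n + 1)
  rw [← laguerre_alt_eval_zero hL0 hL1 hLrec ha hb (n + 1), show (Polynomial.X : ℝ[X]) = Polynomial.X - C 0 by rw [map_zero, sub_zero], resultant_X_sub_C_right _ _ _ hd]

/-- **LAGUERRE, EVERY REAL `α`: `∏_{k ≤ n} (k+1+α) · disc(L_{n+1}) = ((n+1)(n+1+α))^{n+1} · ∏_{k<n} ((k+1)(k+1+α))^{k+1}`.** [Stieltjes 1885; Hilbert 1888; Schur 1931 §3; Szegő (6.71.6); this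
file, §1173] -/
theorem laguerre_discr_mul {L : ℕ → ℝ[X]} {a b : ℕ → ℝ} {α : ℝ} (hL0 : L 0 = 1) (hL1 : L 1 = Polynomial.X - C (a 0))
    (hLrec : ∀ n, L (n + 2) = (Polynomial.X - C (a (n + 1))) * L (n + 1) - C (b (n + 1)) * L n) (ha : ∀ n, a n = 2 * n + 1 + α)
    (hb : ∀ n, b (n + 1) = ((n : ℝ) + 1) * ((n : ℝ) + 1 + α)) (n : ℕ) :
    (∏ k ∈ Finset.range (n + 1), ((k : ℝ) + 1 + α)) * (L (n + 1)).discr =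
      (((n : ℝ) + 1) * ((n : ℝ) + 1 + α)) ^ (n + 1) * ∏ k ∈ Finset.range n, (((k : ℝ) + 1) * ((k : ℝ) + 1 + α)) ^ (k + 1) := by
  have hlow : Polynomial.X * derivative (L (n + 1)) = C ((n : ℝ) + 1) * L (n + 1) + C (((n : ℝ) + 1) * ((n : ℝ) + 1 + α)) * L n :=
    laguerre_structure_relation hL0 hL1 hLrec ha hb n
  have h := resultant_mul_discr_recurrence hL0 hL1 hLrec (d := 1) natDegree_X_le (by rw [natDegree_C]) hlow
  rw [laguerre_resultant_X hL0 hL1 hLrec ha hb n] at h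
  rw [h]
  exact congrArg _ (Finset.prod_congr rfl fun k _ => by rw [hb k])

/-- **STIELTJES–HILBERT: `disc(L_{n+1}^{(α)}) = ∏_{ν=1}^{n+1} ν^ν (ν+α)^{ν−1}`** (monic; valid whenever `(α+1)(α+2)⋯(α+n+1) ≠ 0`). [Stieltjes 1885; Hilbert 1888; Szegő (6.71.6); this file, §1173] -/
theorem laguerre_discr {L : ℕ → ℝ[X]} {a b : ℕ → ℝ} {α : ℝ} (hL0 : L 0 = 1) (hL1 : L 1 = Polynomial.X - C (a 0))
    (hLrec : ∀ n, L (n + 2) = (Polynomial.X - C (a (n + 1))) * L (n + 1) - C (b (n + 1)) * L n) (ha : ∀ n, a n = 2 * n + 1 + α)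
    (hb : ∀ n, b (n + 1) = ((n : ℝ) + 1) * ((n : ℝ) + 1 + α)) {n : ℕ} (hne : ∏ k ∈ Finset.range (n + 1), ((k : ℝ) + 1 + α) ≠ 0) :
    (L (n + 1)).discr = ∏ k ∈ Finset.range (n + 1), ((k : ℝ) + 1) ^ (k + 1) * ((k : ℝ) + 1 + α) ^ k := by
  apply mul_left_cancel₀ hne
  have key : (∏ k ∈ Finset.range (n + 1), ((k : ℝ) + 1 + α)) * ∏ k ∈ Finset.range (n + 1), ((k : ℝ) + 1) ^ (k + 1) * ((k : ℝ) + 1 + α) ^ k =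
      ∏ k ∈ Finset.range (n + 1), (((k : ℝ) + 1) * ((k : ℝ) + 1 + α)) ^ (k + 1) := by
    rw [← Finset.prod_mul_distrib]
    refine Finset.prod_congr rfl fun k _ => ?_
    generalize ((k : ℝ) + 1 + α) = u
    generalize ((k : ℝ) + 1) = v
    ring
  rw [laguerre_discr_mul hL0 hL1 hLrec ha hb n, key, Finset.prod_range_succ _ n]
  ring

/-- The case `α > −1` (all factors `k + 1 + α > 0`). [Szegő (6.71.6); this file, §1173] -/
theorem laguerre_discr_of_gt {L : ℕ → ℝ[X]} {a b : ℕ → ℝ} {α : ℝ} (hL0 : L 0 = 1) (hL1 : L 1 = Polynomial.X - C (a 0))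
    (hLrec : ∀ n, L (n + 2) = (Polynomial.X - C (a (n + 1))) * L (n + 1) - C (b (n + 1)) * L n) (ha : ∀ n, a n = 2 * n + 1 + α)
    (hb : ∀ n, b (n + 1) = ((n : ℝ) + 1) * ((n : ℝ) + 1 + α)) (hα : -1 < α) (n : ℕ) :
    (L (n + 1)).discr = ∏ k ∈ Finset.range (n + 1), ((k : ℝ) + 1) ^ (k + 1) * ((k : ℝ) + 1 + α) ^ k :=
  laguerre_discr hL0 hL1 hLrec ha hb (Finset.prod_ne_zero_iff.2 fun k _ => by have h0 : (0 : ℝ) ≤ k := Nat.cast_nonneg k; linarith)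

/-- **STIELTJES' VALUE OF THE LAGUERRE VANDERMONDE: `(∏_{i<j} (x_j − x_i))² = ∏_{ν=1}^{t+1} ν^ν (ν+α)^{ν−1}`** whenever `L_{t+1}^{(α)} = ∏_k (X − x_k)` (`α > −1`; in particular at the
ordered zeros of N376 `laguerre_zeros`). [Stieltjes 1885; Szegő Thm 6.7.2 ∕ (6.71.6); this file, §1173] -/
theorem laguerre_zeros_discr {L : ℕ → ℝ[X]} {a b : ℕ → ℝ} {α : ℝ} (hL0 : L 0 = 1) (hL1 : L 1 = Polynomial.X - C (a 0))
    (hLrec : ∀ n, L (n + 2) = (Polynomial.X - C (a (n + 1))) * L (n + 1) - C (b (n + 1)) * L n) (ha : ∀ n, a n = 2 * n + 1 + α)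
    (hb : ∀ n, b (n + 1) = ((n : ℝ) + 1) * ((n : ℝ) + 1 + α)) (hα : -1 < α) {t : ℕ} {x : Fin (t + 1) → ℝ} (hxq : L (t + 1) = ∏ k, (Polynomial.X - C (x k))) :
    (∏ i : Fin (t + 1), ∏ j ∈ Finset.Ioi i, (x j - x i)) ^ 2 = ∏ k ∈ Finset.range (t + 1), ((k : ℝ) + 1) ^ (k + 1) * ((k : ℝ) + 1 + α) ^ k := by
  rw [← discr_prod_X_sub_C ℝ x, ← hxq, laguerre_discr_of_gt hL0 hL1 hLrec ha hb hα]

end Summit.Ventures.HSemireg.Wedge.HankelOuter
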